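import Summits.KontsevichZagierPeriods.Zeta5Search.LaiSweepShard

/-!
# `κ₃` sweep certificate — shard file 055 of 127 (shards 385–391 of 889)

HONEST FRAMING. Systematic search; no irrationality claim unless certified. This file only checks,
by `decide +kernel`, shards 385–391 of the order-cell sweep of the `κ₃` point `(74, 2180, 444; δ74)`
(engine `LaiSweepEngine`, soundness `LaiSweepJump/Free/Eval/Shard/Kappa3`; a shard is `⟨regime, n,
p, q, p', q', Lo, Up⟩`: `n` cells from `p/q` to `p'/q'` with integer rate sums in `[Lo, Up]`, `K =
128`, `D = 2^40`). It draws NO conclusion: only the capstone `LaiKappa3SweepCert`, which needs all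
127 shard files, does. Kernel cost of this file ≈ 560 cells × 0.3 s.
-/

namespace Summit.KontsevichZagierPeriods.Zeta5Search.Sweep

set_option maxHeartbeats 100000000 in
/-- Shard 385: 80 cells of regime B from `100/273` to `111/302`.
[cite: Lai2024BallRivoal, §4 Lemma 4.3] -/
theorem shard385 :
    Shard.check 128 (2^40)
      ⟨true, 80, 100, 273, 111, 302, 18997834645317, 21124770163713⟩ = true := by
  decide +kernel

set_option maxHeartbeats 100000000 in
/-- Shard 386: 80 cells of regime B from `111/302` to `45/122`.
[cite: Lai2024BallRivoal, §4 Lemma 4.3] -/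
theorem shard386 :
    Shard.check 128 (2^40)
      ⟨true, 80, 111, 302, 45, 122, 19737548103107, 21964612297202⟩ = true := by
  decide +kernel

set_option maxHeartbeats 100000000 in
/-- Shard 387: 80 cells of regime B from `45/122` to `47/127`.
[cite: Lai2024BallRivoal, §4 Lemma 4.3] -/
theorem shard387 :
    Shard.check 128 (2^40)
      ⟨true, 80, 45, 122, 47, 127, 18538572124437, 20645638863591⟩ = true := by
  decide +kernel

set_option maxHeartbeats 100000000 in
/-- Shard 388: 80 cells of regime B from `47/127` to `88/237`.
[cite: Lai2024BallRivoal, §4 Lemma 4.3] -/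
theorem shard388 :
    Shard.check 128 (2^40)
      ⟨true, 80, 47, 127, 88, 237, 18526146291772, 20647350045238⟩ = true := by
  decide +kernel

set_option maxHeartbeats 100000000 in
/-- Shard 389: 80 cells of regime B from `88/237` to `136/365`.
[cite: Lai2024BallRivoal, §4 Lemma 4.3] -/
theorem shard389 :
    Shard.check 128 (2^40)
      ⟨true, 80, 88, 237, 136, 365, 19458962410056, 21703814255882⟩ = true := by
  decide +kernel

set_option maxHeartbeats 100000000 in
/-- Shard 390: 80 cells of regime B from `136/365` to `157/420`.
[cite: Lai2024BallRivoal, §4 Lemma 4.3] -/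
theorem shard390 :
    Shard.check 128 (2^40)
      ⟨true, 80, 136, 365, 157, 420, 18074979158281, 20175328629505⟩ = true := by
  decide +kernel

set_option maxHeartbeats 100000000 in
/-- Shard 391: 80 cells of regime B from `157/420` to `152/405`.
[cite: Lai2024BallRivoal, §4 Lemma 4.3] -/
theorem shard391 :
    Shard.check 128 (2^40)
      ⟨true, 80, 157, 420, 152, 405, 22336940555249, 24955737601233⟩ = true := by
  decide +kernel

/-- The checked shards of this file, in order. [folklore] -/
def shards055 : List (CheckedShard 128 (2^40)) :=
  [⟨_, shard385⟩, ⟨_, shard386⟩, ⟨_, shard387⟩, ⟨_, shard388⟩, ⟨_, shard389⟩,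
    ⟨_, shard390⟩, ⟨_, shard391⟩]

end Summit.KontsevichZagierPeriods.Zeta5Search.Sweep
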